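import Mathlib
import HarnessLib
import Summits.HubbardSuperconductivity.HubbardSuperconductivity.Theorems.KLProgrammeKLRegimeEngineScaleZeroTwoLegGridSumsWeights
import Summits.HubbardSuperconductivity.HubbardSuperconductivity.Theorems.KLProgrammeKLRegimeEngineV8TwoLegGridMomentsFrameBase

/-!
# Route `KLProgramme` — ENGINE child gen 8 (stmt-HubbardSuperconductivity-20437 `KLRegimeEngineV17F2`), class #7 in GRID currency, located risk #9,
# option (T′-B) «PARAMETRISED MIXED CURRENCY» (pen (R60)/(R60b), check (i′)): the DILATED tree weight `wt_t = 1 + t·diam` (`t ≥ 0`) on grid legs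
# and the `wt_t`-pinned profile `ℓ¹(K) + t·M₁(K)` of the grid vertex `V_N + 𝒩_{K,N}` — the device that turns the submultiplicative `(ℓ¹ + M₁)²`
# bookkeeping of p564283 into the LEIBNIZ form `ℓ¹·(ℓ¹ + 4M₁)` once `t` is optimised (sibling file `…FrameBaseMixed`)

Cell gate-hubbard-kl, seat hubbard-kl-k3c2-p1 g8 (row «scale-0 Gram step»; checker (i′)).  p564283 reads the counterterm vertex through the weight
`wt₁ = 1 + diam`, whose pinned profile is `F = Σ_z ‖Ǩ_L(z)‖(1 + |z|_∞) = ℓ¹(K) + M₁(K)`, and the W-chain bound is quadratic in the profile: the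
space row carries `(4e⁴F + 16e⁸κ₀²|U|)² ∋ 16e⁸·M₁(K)²` — a product of two first moments, which the first moment of a convolution chain never
contains (Leibniz: `M₁(f∗g) ≤ M₁(f)ℓ¹(g) + ℓ¹(f)M₁(g)`).  With the one-parameter family `wt_t = 1 + t·diam` (a tree weight for every `t ≥ 0`;
`≤ wt₁` for `t ≤ 1`, so the covariance's weighted decay constant is unchanged) the profile becomes `ℓ¹(K) + t·M₁(K)` while the pair weight costs
`[x⃗₁ ≠ x⃗₀](1+|Δx̃₀|+|Δx̃₁|) ≤ (2/t)·wt_t`: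

* `isTreeWeight_wtDil`, `wtDil_le_gridLabelWt`, `one_le_wtDil`, `offDiagMomentWeight_le_dil` (constant `2/t`), `wtDil_pair_sameTime`
  (`= 1 + t·|x⃗ − y⃗|_∞`), the profiles `sum_norm_kernel_hubbardGridInteraction_mul_wtDil_le` (`|U||β|/N`),
  `sum_norm_kernel_hubbardGridCounterQuadratic_mul_wtDil_le` (`(|β|/N)·Σ_z ‖Ǩ_L(z)‖(1 + t|z|_∞)`), `sum_norm_kernel_gridVertex_mul_wtDil_le`.

Proofs only; no definitions (the weight is spelled out); nothing about the model is asserted; nothing asserts superconductivity.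
`--supports stmt-HubbardSuperconductivity-20437`.  References: BGM 2006 §3 (3.2)–(3.8) [cite: BenfattoGiulianiMastropietro2006].
-/

noncomputable section

namespace Summit.HubbardSuperconductivity.HubbardSuperconductivity.Theorems.EngineV8

set_option linter.dupNamespace false -- summit = problem name (single-conjunct summit), D-0017

open Real Finset Literature.MathematicalPhysics.QuantumLattice Literature.Probability.LatticeModels
open Literature.Probability.LatticeModels.BattleFederbush GrassmannAlgebra
open Summit.HubbardSuperconductivity.HubbardSuperconductivity.Theorems.KLRegimeSplit
open Summit.HubbardSuperconductivity.HubbardSuperconductivity.Theorems.KLProgrammeLegKernels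

/-! ## §1 The dilated tree weight `1 + t·diam` on grid legs -/

section DilWeight

variable {L Ng : ℕ} [NeZero L] [NeZero Ng]

/-- **`wt_t(S) = 1 + t·diam(S.image gridLegPos)` is a tree weight** for every `t ≥ 0` (`β′ ≥ 0`): `1 + t(s+u) ≤ (1+ts)(1+tu)`. -/
theorem isTreeWeight_wtDil {β' t : ℝ} (hβ' : 0 ≤ β') (ht : 0 ≤ t) :
    IsTreeWeight (fun S : Finset (GridLeg (GridPoint L Ng)) => diamWeight (fun s => 1 + t * s) (gridLabelDist L Ng β') (S.image gridLegPos)) :=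
  (isTreeWeight_diamWeight (isLabelDist_gridLabelDist L Ng hβ') (fun s hs => by nlinarith) (fun s u hs hsu => by nlinarith)
    (fun s u hs hu => by nlinarith [mul_nonneg hs hu, mul_nonneg ht (mul_nonneg hs hu), sq_nonneg t])).comap gridLegPos

omit [NeZero L] [NeZero Ng] in
/-- `wt_t ≤ wt₁ = gridLabelWt` for `0 ≤ t ≤ 1`. -/
theorem wtDil_le_gridLabelWt {β' t : ℝ} (ht1 : t ≤ 1) (T : Finset (ZMod Ng × TorusSite 2 L)) :
    diamWeight (fun s => 1 + t * s) (gridLabelDist L Ng β') T ≤ gridLabelWt L Ng β' T := by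
  rw [diamWeight, gridLabelWt_apply]
  have := labelDiam_nonneg (gridLabelDist L Ng β') T
  nlinarith

omit [NeZero L] [NeZero Ng] in
/-- `1 ≤ wt_t` for `t ≥ 0`. -/
theorem one_le_wtDil {β' t : ℝ} (ht : 0 ≤ t) (T : Finset (ZMod Ng × TorusSite 2 L)) :
    1 ≤ diamWeight (fun s => 1 + t * s) (gridLabelDist L Ng β') T := by
  rw [diamWeight]
  have := labelDiam_nonneg (gridLabelDist L Ng β') T
  nlinarith

/-- **The off-diagonal first-moment weight against the dilated weight**: `[x⃗₁ ≠ x⃗₀](1 + |Δx̃₀| + |Δx̃₁|) ≤ (2/t)·wt_t((image Y).image gridLegPos)`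
for `0 < t ≤ 1` (`|Δx̃ᵢ| ≤ |x⃗₁ − x⃗₀|_∞ ≤ diam`, `1 + 2D ≤ 2/t + 2D`). -/
theorem offDiagMomentWeight_le_dil {β' t : ℝ} (hβ' : 0 ≤ β') (ht0 : 0 < t) (ht1 : t ≤ 1) (Y : Fin 2 → GridLeg (GridPoint L Ng)) :
    (if (Y 1).1.1.2 - (Y 0).1.1.2 = 0 then (0 : ℝ) else
      (1 + ((((Y 1).1.1.2 - (Y 0).1.1.2) 0).valMinAbs.natAbs : ℝ) + ((((Y 1).1.1.2 - (Y 0).1.1.2) 1).valMinAbs.natAbs : ℝ))) ≤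
      2 / t * diamWeight (fun s => 1 + t * s) (gridLabelDist L Ng β') ((univ.image Y).image gridLegPos) := by
  have h0 := natAbs_valMinAbs_sub_le_torusSiteDist (Y 0).1.1.2 (Y 1).1.1.2 0
  have h1 := natAbs_valMinAbs_sub_le_torusSiteDist (Y 0).1.1.2 (Y 1).1.1.2 1
  have hd : torusSiteDist (Y 0).1.1.2 (Y 1).1.1.2 ≤ labelDiam (gridLabelDist L Ng β') ((univ.image Y).image gridLegPos) := by
    refine (torusSiteDist_le_gridLabelDist_gridLegPos hβ' Y).trans ?_
    rw [Finset.image_image]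
    exact le_labelDiam _ (mem_image_of_mem _ (mem_univ 0)) (mem_image_of_mem _ (mem_univ 1))
  have hD0 : 0 ≤ labelDiam (gridLabelDist L Ng β') ((univ.image Y).image gridLegPos) := labelDiam_nonneg _ _
  have h2t : (2 : ℝ) ≤ 2 / t := by rw [le_div_iff₀ ht0]; nlinarith
  have hexp : 2 / t * diamWeight (fun s => 1 + t * s) (gridLabelDist L Ng β') ((univ.image Y).image gridLegPos) =
      2 / t + 2 * labelDiam (gridLabelDist L Ng β') ((univ.image Y).image gridLegPos) := by
    rw [diamWeight]; field_simp
  rw [hexp]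
  split_ifs
  · positivity
  · linarith

/-- **Weighted pinned sums of the quartic grid vertex, dilated weight** (`0 ≤ t ≤ 1`): `≤ |U|·|β|/N` (`1 ≤ wt_t ≤ wt₁ = 1` on the support). -/
theorem sum_norm_kernel_hubbardGridInteraction_mul_wtDil_le (β U β' : ℝ) {t : ℝ} (ht0 : 0 ≤ t) (ht1 : t ≤ 1) (q : Fin 4)
    (w : GridLeg (GridPoint L Ng)) :
    ∑ X ∈ univ.filter (fun X : Fin 4 → GridLeg (GridPoint L Ng) => X q = w),
        ‖kernel ℂ (hubbardGridInteraction L Ng β U) 4 X‖ * diamWeight (fun s => 1 + t * s) (gridLabelDist L Ng β') ((univ.image X).image gridLegPos) ≤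
      |U| * |β| / Ng := by
  refine le_trans (sum_le_sum fun X _ => ?_) (sum_norm_kernel_hubbardGridInteraction_le β U q w)
  by_cases hX : kernel ℂ (hubbardGridInteraction L Ng β U) 4 X = 0
  · rw [hX, norm_zero, zero_mul]
  · have h1 := (wtDil_le_gridLabelWt (L := L) (Ng := Ng) (β' := β') ht1 ((univ.image X).image gridLegPos)).trans_eq
      (gridLabelWt_image_eq_one_of_kernel_hubbardGridInteraction_ne_zero β β' U X hX)
    have h2 := one_le_wtDil (L := L) (Ng := Ng) (β' := β') ht0 ((univ.image X).image gridLegPos)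
    rw [le_antisymm h1 h2, mul_one]

/-- The dilated pair weight of the two legs of a time-local hopping monomial `ψ⁺_{(j,x⃗)} ψ⁻_{(j,y⃗)}`: `1 + t·|x⃗ − y⃗|_∞`. -/
theorem wtDil_pair_sameTime {β' : ℝ} (hβ' : 0 ≤ β') (t : ℝ) (j : Fin Ng) (x y : TorusSite 2 L) (σ σ' c c' : Fin 2) :
    diamWeight (fun s => 1 + t * s) (gridLabelDist L Ng β')
        {gridLegPos ((((j, x), σ), c) : GridLeg (GridPoint L Ng)), gridLegPos ((((j, y), σ'), c') : GridLeg (GridPoint L Ng))} =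
      1 + t * torusSiteDist (x - y) 0 := by
  rw [diamWeight_pair (isLabelDist_gridLabelDist L Ng hβ'), gridLegPos_apply, gridLegPos_apply, gridLabelDist_apply,
    (isLabelDist_cyclicDist Ng).self, mul_zero, zero_add, torusSiteDist_eq_sub_zero]

/-- **Weighted pinned sums of the grid counterterm, dilated weight** (`t ≥ 0`):
`Σ_{Y : Y p = w} ‖kernel 𝒩_{K,N} 2 Y‖·wt_t ≤ (|β|/N)·Σ_z ‖Ǩ_L(z)‖·(1 + t·|z|_∞)` — the profile `ℓ¹(K) + t·M₁(K)`. -/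
theorem sum_norm_kernel_hubbardGridCounterQuadratic_mul_wtDil_le (β : ℝ) {β' : ℝ} (hβ' : 0 ≤ β') {t : ℝ} (ht : 0 ≤ t) (K : TrigPolyC4v)
    (p : Fin 2) (w : GridLeg (GridPoint L Ng)) :
    ∑ Y ∈ univ.filter (fun Y : Fin 2 → GridLeg (GridPoint L Ng) => Y p = w),
        ‖kernel ℂ (hubbardGridCounterQuadratic L Ng β K) 2 Y‖ * diamWeight (fun s => 1 + t * s) (gridLabelDist L Ng β') ((univ.image Y).image gridLegPos) ≤
      |β| / Ng * ∑ z : TorusSite 2 L, ‖framePosKernel L K z‖ * (1 + t * torusSiteDist z 0) := by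
  rw [hubbardGridCounterQuadratic_eq_sum]
  set ω : (Fin 2 → GridLeg (GridPoint L Ng)) → ℝ := fun Y =>
    diamWeight (fun s => 1 + t * s) (gridLabelDist L Ng β') ((univ.image Y).image gridLegPos) with hω
  set φ : Fin 2 × (GridPoint L Ng × TorusSite 2 L) → ℝ := fun i => 1 + t * torusSiteDist (i.2.1.2 - i.2.2) 0 with hφ
  have hpairset : ∀ u v : GridLeg (GridPoint L Ng), (univ.image ![u, v]).image gridLegPos = {gridLegPos u, gridLegPos v} := by
    intro u v
    rw [image_image]
    ext z
    simp only [mem_image, mem_univ, true_and, Function.comp_apply, Fin.exists_fin_two, Matrix.cons_val_zero, Matrix.cons_val_one,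
      mem_insert, mem_singleton]
    constructor
    · rintro (h | h)
      exacts [Or.inl h.symm, Or.inr h.symm]
    · rintro (h | h)
      exacts [Or.inl h.symm, Or.inr h.symm]
  have hsym : ∀ x y : TorusSite 2 L, torusSiteDist (y - x) 0 = torusSiteDist (x - y) 0 := fun x y => by
    rw [torusSiteDist, torusSiteDist, torusDist, torusDist, sub_zero, sub_zero, ← neg_sub, torusNorm_neg]
  have hφa : ∀ i ∈ (univ : Finset (Fin 2 × (GridPoint L Ng × TorusSite 2 L))),
      ω ![(((i.2.1, i.1), 0) : GridLeg (GridPoint L Ng)), ((((i.2.1.1, i.2.2), i.1), 1) : GridLeg (GridPoint L Ng))] ≤ φ i := by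
    intro i _
    rw [hω]; dsimp only
    rw [hpairset, show i.2.1 = (i.2.1.1, i.2.1.2) from rfl, wtDil_pair_sameTime hβ']
  have hφb : ∀ i ∈ (univ : Finset (Fin 2 × (GridPoint L Ng × TorusSite 2 L))),
      ω ![((((i.2.1.1, i.2.2), i.1), 1) : GridLeg (GridPoint L Ng)), (((i.2.1, i.1), 0) : GridLeg (GridPoint L Ng))] ≤ φ i := by
    intro i _
    rw [hω]; dsimp only
    rw [hpairset, show i.2.1 = (i.2.1.1, i.2.1.2) from rfl, wtDil_pair_sameTime hβ', hsym]
  refine sum_norm_kernel_two_structured_mul_wt_le univ _ _ _ ω (fun Y => zero_le_one.trans (one_le_wtDil (L := L) (Ng := Ng) (β' := β') ht _))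
    φ hφa hφb (fun w' => ?_) (fun w' => ?_) p w
  · -- `ψ⁺`-pinned
    set s := (univ : Finset (Fin 2 × (GridPoint L Ng × TorusSite 2 L))).filter
      (fun i => ((((i.2.1, i.1), 0) : GridLeg (GridPoint L Ng))) = w') with hs
    have hmem : ∀ i ∈ s, i.2.1 = w'.1.1 ∧ i.1 = w'.1.2 := by
      intro i hi
      rw [hs, mem_filter] at hi
      have h := hi.2
      exact ⟨by rw [← h], by rw [← h]⟩
    have hinj : Set.InjOn (fun i : Fin 2 × (GridPoint L Ng × TorusSite 2 L) => i.2.2) s := by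
      intro i hi i' hi' h
      obtain ⟨h1, h2⟩ := hmem i hi
      obtain ⟨h1', h2'⟩ := hmem i' hi'
      exact Prod.ext (h2.trans h2'.symm) (Prod.ext (h1.trans h1'.symm) h)
    set g : TorusSite 2 L → ℝ := fun y => |β| / Ng * (‖framePosKernel L K (w'.1.1.2 - y)‖ * (1 + t * torusSiteDist (w'.1.1.2 - y) 0)) with hg
    have hcongr : ∀ i ∈ s, ‖(((β / Ng : ℝ)) : ℂ) * framePosKernel L K (i.2.1.2 - i.2.2)‖ * φ i = g i.2.2 := by
      intro i hi
      simp only [hg, hφ]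
      rw [(hmem i hi).1, norm_mul, Complex.norm_real, Real.norm_eq_abs, abs_div, Nat.abs_cast]
      ring
    have hg0 : ∀ y, 0 ≤ g y := fun y => by
      rw [hg]
      have : (0 : ℝ) ≤ torusSiteDist (w'.1.1.2 - y) 0 := Nat.cast_nonneg _
      have : 0 ≤ 1 + t * torusSiteDist (w'.1.1.2 - y) 0 := by nlinarith
      positivity
    calc ∑ i ∈ s, ‖(((β / Ng : ℝ)) : ℂ) * framePosKernel L K (i.2.1.2 - i.2.2)‖ * φ i = ∑ i ∈ s, g i.2.2 := sum_congr rfl hcongr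
      _ = ∑ y ∈ s.image (fun i : Fin 2 × (GridPoint L Ng × TorusSite 2 L) => i.2.2), g y := (sum_image hinj).symm
      _ ≤ ∑ y : TorusSite 2 L, g y := sum_le_sum_of_subset_of_nonneg (subset_univ _) fun y _ _ => hg0 y
      _ = |β| / Ng * ∑ y : TorusSite 2 L, ‖framePosKernel L K (w'.1.1.2 - y)‖ * (1 + t * torusSiteDist (w'.1.1.2 - y) 0) := by
          rw [hg, ← mul_sum]
      _ = |β| / Ng * ∑ z : TorusSite 2 L, ‖framePosKernel L K z‖ * (1 + t * torusSiteDist z 0) := by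
          congr 1
          exact Fintype.sum_equiv (Equiv.subLeft w'.1.1.2) _ _ fun y => rfl
  · -- `ψ⁻`-pinned
    set s := (univ : Finset (Fin 2 × (GridPoint L Ng × TorusSite 2 L))).filter
      (fun i => (((((i.2.1.1, i.2.2), i.1), 1) : GridLeg (GridPoint L Ng))) = w') with hs
    have hmem : ∀ i ∈ s, i.2.1.1 = w'.1.1.1 ∧ i.2.2 = w'.1.1.2 ∧ i.1 = w'.1.2 := by
      intro i hi
      rw [hs, mem_filter] at hi
      have h := hi.2
      exact ⟨by rw [← h], by rw [← h], by rw [← h]⟩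
    have hinj : Set.InjOn (fun i : Fin 2 × (GridPoint L Ng × TorusSite 2 L) => i.2.1.2) s := by
      intro i hi i' hi' h
      obtain ⟨h1, h2, h3⟩ := hmem i hi
      obtain ⟨h1', h2', h3'⟩ := hmem i' hi'
      exact Prod.ext (h3.trans h3'.symm) (Prod.ext (Prod.ext (h1.trans h1'.symm) h) (h2.trans h2'.symm))
    set g : TorusSite 2 L → ℝ := fun x => |β| / Ng * (‖framePosKernel L K (x - w'.1.1.2)‖ * (1 + t * torusSiteDist (x - w'.1.1.2) 0)) with hg
    have hcongr : ∀ i ∈ s, ‖(((β / Ng : ℝ)) : ℂ) * framePosKernel L K (i.2.1.2 - i.2.2)‖ * φ i = g i.2.1.2 := by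
      intro i hi
      simp only [hg, hφ]
      rw [(hmem i hi).2.1, norm_mul, Complex.norm_real, Real.norm_eq_abs, abs_div, Nat.abs_cast]
      ring
    have hg0 : ∀ x, 0 ≤ g x := fun x => by
      rw [hg]
      have : (0 : ℝ) ≤ torusSiteDist (x - w'.1.1.2) 0 := Nat.cast_nonneg _
      have : 0 ≤ 1 + t * torusSiteDist (x - w'.1.1.2) 0 := by nlinarith
      positivity
    calc ∑ i ∈ s, ‖(((β / Ng : ℝ)) : ℂ) * framePosKernel L K (i.2.1.2 - i.2.2)‖ * φ i = ∑ i ∈ s, g i.2.1.2 := sum_congr rfl hcongr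
      _ = ∑ x ∈ s.image (fun i : Fin 2 × (GridPoint L Ng × TorusSite 2 L) => i.2.1.2), g x := (sum_image hinj).symm
      _ ≤ ∑ x : TorusSite 2 L, g x := sum_le_sum_of_subset_of_nonneg (subset_univ _) fun x _ _ => hg0 x
      _ = |β| / Ng * ∑ x : TorusSite 2 L, ‖framePosKernel L K (x - w'.1.1.2)‖ * (1 + t * torusSiteDist (x - w'.1.1.2) 0) := by
          rw [hg, ← mul_sum]
      _ = |β| / Ng * ∑ z : TorusSite 2 L, ‖framePosKernel L K z‖ * (1 + t * torusSiteDist z 0) := by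
          congr 1
          exact Fintype.sum_equiv (Equiv.subRight w'.1.1.2) _ _ fun x => rfl

omit [NeZero Ng] in
/-- The dilated profile of the grid vertex is nonnegative (`t ≥ 0`). -/
theorem scaleZeroPinnedDil_nonneg (β U : ℝ) (K : TrigPolyC4v) {t : ℝ} (ht : 0 ≤ t) (m' : ℕ) :
    0 ≤ (if m' = 1 then |β| / Ng * ∑ z : TorusSite 2 L, ‖framePosKernel L K z‖ * (1 + t * torusSiteDist z 0)
      else if m' = 2 then |U| * |β| / Ng else 0 : ℝ) := by
  split_ifs
  · refine mul_nonneg (by positivity) (sum_nonneg fun z _ => mul_nonneg (norm_nonneg _) ?_)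
    have : (0 : ℝ) ≤ torusSiteDist z 0 := Nat.cast_nonneg _
    nlinarith
  · positivity
  · exact le_rfl

/-- **The dilated pinned profile of the grid vertex** `V_N + 𝒩_{K,N}` (`0 ≤ t ≤ 1`): `N_t(1) = (|β|/N)·Σ_z ‖Ǩ_L(z)‖(1 + t|z|_∞)`,
`N_t(2) = |U||β|/N`, `0` otherwise. -/
theorem sum_norm_kernel_gridVertex_mul_wtDil_le (β U : ℝ) {β' : ℝ} (hβ' : 0 ≤ β') {t : ℝ} (ht0 : 0 ≤ t) (ht1 : t ≤ 1) (K : TrigPolyC4v)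
    (m' : ℕ) (j : Fin (2 * m')) (w : GridLeg (GridPoint L Ng)) :
    ∑ Y ∈ univ.filter (fun Y : Fin (2 * m') → GridLeg (GridPoint L Ng) => Y j = w),
        ‖kernel ℂ (hubbardGridInteraction L Ng β U + hubbardGridCounterQuadratic L Ng β K) (2 * m') Y‖ *
          diamWeight (fun s => 1 + t * s) (gridLabelDist L Ng β') ((univ.image Y).image gridLegPos) ≤
      (if m' = 1 then |β| / Ng * ∑ z : TorusSite 2 L, ‖framePosKernel L K z‖ * (1 + t * torusSiteDist z 0)
        else if m' = 2 then |U| * |β| / Ng else 0 : ℝ) := by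
  rcases m' with _ | _ | _ | m'
  · exact absurd j.2 (by omega)
  · have h : ∀ Y : Fin (2 * 1) → GridLeg (GridPoint L Ng),
        kernel ℂ (hubbardGridInteraction L Ng β U + hubbardGridCounterQuadratic L Ng β K) (2 * 1) Y =
          kernel ℂ (hubbardGridCounterQuadratic L Ng β K) 2 Y := fun Y => by
      rw [kernel_add, kernel_hubbardGridInteraction_of_ne β U (by norm_num) Y, zero_add]
    simp only [h, if_true]
    exact sum_norm_kernel_hubbardGridCounterQuadratic_mul_wtDil_le β hβ' ht0 K j w
  · have h : ∀ Y : Fin (2 * 2) → GridLeg (GridPoint L Ng),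
        kernel ℂ (hubbardGridInteraction L Ng β U + hubbardGridCounterQuadratic L Ng β K) (2 * 2) Y =
          kernel ℂ (hubbardGridInteraction L Ng β U) 4 Y := fun Y => by
      rw [kernel_add, kernel_hubbardGridCounterQuadratic_of_ne β K (by norm_num) Y, add_zero]
    simp only [h, show (1 + 1 : ℕ) = 2 from rfl, if_true, show (2 : ℕ) ≠ 1 by norm_num, if_false]
    exact sum_norm_kernel_hubbardGridInteraction_mul_wtDil_le β U β' ht0 ht1 j w
  · refine le_of_eq_of_le (sum_eq_zero fun Y _ => ?_) (scaleZeroPinnedDil_nonneg β U K ht0 _)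
    rw [kernel_gridVertex_of_two_lt β U K (m' + 3) (by omega) Y, norm_zero, zero_mul]

end DilWeight

end Summit.HubbardSuperconductivity.HubbardSuperconductivity.Theorems.EngineV8

end
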